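import Literature.NumberTheory.Automorphic.AdelicHeightGLProofs
import Literature.NumberTheory.GaloisRepresentations.GSp4BigImage

/-!
# Sanity lemmas for the pub-residmod REVIEW-RUNBOOK (cards `GLn.localHeight`, `GLn.archHeight`, `spAdjoint`)

Review evidence only (ops-runbook sanity registry `registry/pub-residmod.json`); no new definitions, no new
mathematics.  Three definitions of data in the statement closure of `Summit.Ventures.ResidMod.modular_of_mod2RowNOS`
had no lemma about them inside the probe's import cone:

* the Borel–Jacquet local / archimedean heights `H_v`, `H_∞` on `GL_n(𝔸_K)` (`AdelicGLnGlue.lean`): the EXPLICIT VALUE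
  at the identity, `H_v(1) = 1` and `H_∞(1) = 1` (`n ≥ 1`) — (b)-type evidence that the junk conventions (`0` only for
  `n = 0`) and the `max (‖g‖, ‖g⁻¹‖)` shape are as the docstrings say; the inequalities `H_v ≥ 1`, `H_v ≤ 1` on
  `GL_n(𝒪_v)`, `H_v = 1` almost everywhere, `H_∞ > 0`, submultiplicativity are the tree's `AdelicHeightGLProofs.lean`
  (imported here, hence listed by the kernel on the same cards);
* `spAdjoint J` (`GSp4BigImage.lean`), `ad⁰ = 𝔰𝔭(J)` as a subrepresentation of the adjoint action of `GSp(J)`: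
  membership IS membership in `𝔰𝔭(J) = {X : Xᵀ J + J X = 0}` (agreement with the card `spLie`), with an explicit
  member (`diag(1, -1)`) and an explicit non-member (the identity) for the standard symplectic `J` on `k²`, `char k ≠ 2`.
-/

noncomputable section

open scoped MatrixGroups NNReal Classical      -- `Classical`: the Mathlib instances on `mixedSpace K` need decidability of `IsReal` / `IsComplex` (AdelicGLnGlue note H5)
open NumberField NumberField.mixedEmbedding IsDedekindDomain Matrix

/-! ### Heights at the identity -/

namespace Summit.Ventures.ResidMod.Runbook

open Literature.NumberTheory.Automorphic Literature.NumberTheory.GaloisRepresentations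

section Heights

variable {n : ℕ} {K : Type} [Field K] [NumberField K]

/-- `H_v(1) = 1` at every finite place (`n ≥ 1`): the identity and its inverse have `v`-integral entries, and
`H_v ≥ 1` always. -/
theorem localHeight_one [NeZero n] (v : HeightOneSpectrum (𝓞 K)) : GLn.localHeight n K v 1 = 1 := by
  refine le_antisymm (GLn.localHeight_le_one_of_forall_mem v 1 (fun i j => ?_) (fun i j => ?_))
    (GLn.one_le_localHeight v 1)
  all_goals
    first | rw [inv_one, Units.val_one] | rw [Units.val_one]
    by_cases h : i = j
    · subst h
      rw [Matrix.one_apply_eq]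
      exact one_mem _          -- `(1 : 𝔸_K).2 v = 1` definitionally (product ring, restricted product)
    · rw [Matrix.one_apply_ne h]
      exact zero_mem _

/-- The sup-norm of `1 ∈ K_∞ = ℝ^{r₁} × ℂ^{r₂}` is `1` (a number field has an infinite place, so one factor is
non-empty). -/
theorem norm_one_mixedSpace : ‖(1 : mixedSpace K)‖ = 1 := by
  refine le_antisymm ?_ ?_
  · rw [Prod.norm_def, Prod.fst_one, Prod.snd_one]
    exact max_le (pi_norm_le_iff_of_nonneg zero_le_one |>.2 fun _ => by simp)
      (pi_norm_le_iff_of_nonneg zero_le_one |>.2 fun _ => by simp)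
  · obtain ⟨w⟩ := (inferInstance : Nonempty (InfinitePlace K))
    rw [Prod.norm_def, Prod.fst_one, Prod.snd_one]
    rcases w.isReal_or_isComplex with hw | hw
    · refine le_trans ?_ (le_max_left _ _)
      calc (1 : ℝ) = ‖(1 : {w : InfinitePlace K // w.IsReal} → ℝ) ⟨w, hw⟩‖ := by simp
        _ ≤ _ := norm_le_pi_norm _ _
    · refine le_trans ?_ (le_max_right _ _)
      calc (1 : ℝ) = ‖(1 : {w : InfinitePlace K // w.IsComplex} → ℂ) ⟨w, hw⟩‖ := by simp
        _ ≤ _ := norm_le_pi_norm _ _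

/-- `H_∞(1) = 1` (`n ≥ 1`): `g_∞ = 1`, whose entries have sup-norm `1` on the diagonal and `0` off it. -/
theorem archHeight_one [NeZero n] : GLn.archHeight n K 1 = 1 := by
  unfold GLn.archHeight
  rw [map_one, inv_one, Units.val_one]
  refine le_antisymm (Finset.sup_le fun ij _ => ?_) ?_
  · by_cases h : ij.1 = ij.2
    · rw [h, Matrix.one_apply_eq, sup_idem, ← NNReal.coe_le_coe, coe_nnnorm, norm_one_mixedSpace, NNReal.coe_one]
    · rw [Matrix.one_apply_ne h, nnnorm_zero, sup_idem]
      exact zero_le_one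
  · have i0 : Fin n := ⟨0, Nat.pos_of_ne_zero (NeZero.ne n)⟩
    refine le_trans ?_ (Finset.le_sup (b := (i0, i0)) (Finset.mem_univ _))
    rw [Matrix.one_apply_eq, sup_idem, ← NNReal.coe_le_coe, coe_nnnorm, norm_one_mixedSpace, NNReal.coe_one]

end Heights

/-! ### `spAdjoint`: membership, a member, a non-member -/

section SpAdjoint

universe u

variable {k : Type u} [Field k] {n : ℕ}

/-- Membership in `ad⁰ = spAdjoint J` IS membership in the Lie algebra `𝔰𝔭(J)` (the subrepresentation adds only
the `GSp(J)`-stability proof, no condition on elements). -/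
theorem mem_spAdjoint_iff (J : Matrix (Fin n) (Fin n) k) (X : Matrix (Fin n) (Fin n) k) :
    X ∈ spAdjoint J ↔ X ∈ spLie J := Iff.rfl

/-- … i.e. the printed condition `Xᵀ J + J X = 0` (BCGP Def. 7.5.2). -/
theorem mem_spAdjoint_iff_eq (J : Matrix (Fin n) (Fin n) k) (X : Matrix (Fin n) (Fin n) k) :
    X ∈ spAdjoint J ↔ Xᵀ * J + J * X = 0 := Iff.rfl

/-- The underlying submodule of `spAdjoint J` is `spLie J` itself. -/
theorem spAdjoint_toSubmodule (J : Matrix (Fin n) (Fin n) k) : (spAdjoint J).toSubmodule = spLie J := rfl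

/-- NON-VACUITY for the standard symplectic form `J = [[0, 1], [-1, 0]]` on `k²`: `diag(1, -1)` lies in `ad⁰`
(it is the standard torus direction of `𝔰𝔭₂ = 𝔰𝔩₂`). -/
theorem diag_mem_spAdjoint_two : (!![1, 0; 0, -1] : Matrix (Fin 2) (Fin 2) k) ∈ spAdjoint (!![0, 1; -1, 0]) := by
  rw [mem_spAdjoint_iff_eq]
  ext i j
  fin_cases i <;> fin_cases j <;> simp [Matrix.mul_apply, Fin.sum_univ_two]

/-- … and `ad⁰` is a PROPER subspace: the identity matrix is not in it when `2 ≠ 0` in `k`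
(`1ᵀ J + J 1 = 2 J ≠ 0`). -/
theorem one_not_mem_spAdjoint_two [NeZero (2 : k)] :
    (1 : Matrix (Fin 2) (Fin 2) k) ∉ spAdjoint (!![0, 1; -1, 0] : Matrix (Fin 2) (Fin 2) k) := by
  rw [mem_spAdjoint_iff_eq, transpose_one, Matrix.one_mul, Matrix.mul_one]
  intro h
  have h01 : (1 : k) + 1 = 0 := by simpa using congr_fun (congr_fun h 0) 1
  rw [one_add_one_eq_two] at h01
  exact two_ne_zero h01

end SpAdjoint

end Summit.Ventures.ResidMod.Runbook

end
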